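import Mathlib
import HarnessLib
import HarnessLib.Audit
import Summits.AtomisticToContinuum.Statement
import Literature.MathematicalPhysics.KineticTheory.BackwardCluster
import HarnessLib.Audit.Status.Attr

/-!
Route: RelayRaceLocality

DORMANT since 2026-08-24T06:29:56Z (reconciler: no traction for 6.6 d (last activity item-evidence-added at 2026-08-17T16:00:57Z); parked, not closed — `ledger route dormant route-AtomisticToContinuum-RelayRaceLocality --off` to reactiv) — unstaffed, not closed; items shared with open routes are served there. `ledger route dormant <id> --off` reactivates.

# Route RelayRaceLocality — a relay-race (Lieb–Robinson) light cone for billiard balls makes the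
hydrodynamic limit local — Gibbs cone + cone in law + near-constant short-time limit + restart

X = LightConeInLaw ∧ NearConstantShortTimeHL ∧ RestartPrinciple ("it suffices to show"), re-opened
after the D-0027 §2.1 audit of
2026-08-15 with a deciding theorem `closes : … → _root_.HydrodynamicLimit` (the retired draft was
route-AtomisticToContinuum-RelayRaceLightCone,
same card). LightConeInLaw (the ENGINE, card relay-race-light-cone): for the fixed-density
hard-sphere gas started from local Gibbs data there is
a LIGHT CONE IN LAW with an N-independent speed c = c(M) (M bounds temperature and drift of the
nominal pre-shock Euler fields, packing < η₀):
the law of the reduced empirical fields tested inside B(x₀, R − c t) at time t is asymptotically the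
same for any two such gases (same sphere
diameter, any particle numbers) whose time-0 Euler data agree on B(x₀, R) in reduced units. Its
first rung is the NEW typed one-copy statement
GibbsLightCone = the card's equilibrium theorem LR-G over the tree's APST backward clusters
(`HardSphereFlow.backwardCluster`): under the global
Gibbs law every particle in the backward cluster of i over (0, t] started within c t + δ of x_i(t),
with probability → 1. NearConstantShortTimeHL
(foreign input): amplitude-δ₀(M) data with C¹ guards M follow classical hs-Euler for t < τ₀(M), for
general diameter/number families.
RestartPrinciple (foreign input): the short-time guarded limit S for all smooth profiles ⇒ the
packing-guarded conjunct, which since the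
statement re-type of 2026-08-16 (p126922, D-0032) IS the sub-problem decl `_root_.HydrodynamicLimit`
verbatim (the consequent of
RestartPrinciple and the Statement body coincide). Glue: ConeLocalisation (cone + near-constant
theorem ⇒ S by flattening outside a ball
and Euler's domain of dependence). Route-repair rev 1 (2026-08-16): the shared guard-remover
DiluteSelfConsistency
(stmt-AtomisticToContinuum-3091) is dropped from this route — the packing guard `∀ t ∈ Ico 0 T, ∀ x,
ρ t x * σ ^ 3 < η₀` is now a
HYPOTHESIS of the Statement, so nothing has to remove it — and the Assembly item is restated
crux-only as X → Statement
(LightConeInLaw → NearConstantShortTimeHL → RestartPrinciple → HydrodynamicLimit: ConeLocalisation's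
content plus the logic of `closes`).
Lean: `LightConeInLaw ∧ NearConstantShortTimeHL ∧ RestartPrinciple`

## Assembly
Pure logic, certified natively (rev 1, 2026-08-16, after the statement re-type p126922):
ConeLocalisation applied to LightConeInLaw and
NearConstantShortTimeHL gives the short-time guarded limit S; RestartPrinciple turns S into the
packing-guarded conjunct, which is
`_root_.HydrodynamicLimit` by `def` unfolding. Deciding theorem: `closes (_h₁ : GibbsLightCone) (h₂
: LightConeInLaw)
(h₃ : NearConstantShortTimeHL) (h₄ : RestartPrinciple) (h₅ : ConeLocalisation) :
_root_.HydrodynamicLimit := h₄ (h₅ h₂ h₃)`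
(GibbsLightCone, the rung, is carried but not consumed). The Assembly ITEM is, since rev 1, the
crux-only implication
LightConeInLaw → NearConstantShortTimeHL → RestartPrinciple → HydrodynamicLimit (not pure logic: it
packages the support
ConeLocalisation; once that is proved it is `fun h₂ h₃ h₄ => h₄ (cone h₂ h₃)`); the rev-0 form
LightConeInLaw → NearConstantShortTimeHL →
ConeLocalisation → RestartPrinciple → DiluteSelfConsistency → HydrodynamicLimit (stmt-12505, proved
against the unguarded statement by
Theorems/RelayRaceLocalityAssembly.lean, which no longer compiles after the re-type) is superseded.

Rationale: WHY THIS LINE. The card imports the Lieb–Robinson architecture — path counting × per-bond bounds ×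
Chernoff along the path (doi:10.1007/bf01645779;
classical lattices MarchioroEtAl1978, ButtaEtAl2007, NachtergaeleEtAl2008, RazSims2009) — into the
continuum hard-sphere gas at FIXED
reduced density by measuring the span of a causal (relay) chain in FLIGHT LENGTHS: the mean free
path ℓ = (N+1)^(-1/3)/(√2πσ²) is geometric,
so Maxwellian tails drop out and the cone speed is (links per unit time) × ℓ × (entropy of the 2^k
relay choices) = κ₁√θ, N-independent,
with tails e^(-cδσ²(N+1)^(1/3)) under Gibbs; the per-link inputs are static (Palm/GNZ structure of
the low-activity hard-core state,
Ruelle1969 Ch. 4, GeorgiiZessin1993; one-flight clusters Alexander1975) plus an energy-share bound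
against focusing relays (card audit T9),
and the objects are the tree's own: the APST backward cluster (AokiPulvirentiSimonellaTsuji2015 §5,
PulvirentiSimonella2021, whose printed
estimates bound its CARDINALITY in the Boltzmann–Grad regime — here we bound its SPATIAL SPAN at
fixed density, where the cardinality is
useless, ≍ e^(C N^(1/3) t)). What the cone buys for the conjunct is LOCALITY: the hydrodynamic limit
for an arbitrary smooth profile over a
short time becomes the limit of a NEAR-CONSTANT comparison gas (the one regime with
perturbative/spectral tools, Spohn1991 §7.1, Doyon2022),
and the large-data problem becomes a restart problem; no open route states a propagation bound (26
open/draft route files read), and the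
three HydrodynamicLimit negatives (EnskogAdjointDuality 9168: untied Euler data on the junk EOS
branch; WarmColdDichotomy 9236/9238:
degenerate thresholds) are avoided by tying every Euler solution to the local Gibbs data through the
LLN hypothesis and by ∃-quantified
constants. Areas imported: quantum/classical lattice locality bounds, Gibbs point-process (Palm)
theory, first-passage/branching-random-walk
fronts, hyperbolic domain-of-dependence PDE facts.

RANKED CRUXES. #2 LightConeInLaw (crux) — LIGHT CONE IN LAW (card LR-G/M1–M5, two-copy form): ∃ η₀ ∀
M ∃ c > 0 such that for two hard-sphere gases on 𝕋³ with the SAME diameter hsDiameter σ₁ N — gas 1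
the conjunct's (N+1 spheres, local Gibbs profile (a₁,u₁,θ₁)), gas 2 any comparison gas (n₂(N)
spheres, n₂ε³ → σ₂³, local Gibbs profile (a₂,u₂,θ₂)) — whose laws are probability measures with LLN
at t = 0 towards classical hs-Euler data that AGREE on B(x₀,R) in reduced units (ρσ³, u, θ) and
whose nominal fields obey packing < η₀, θ ≤ M, |u| ≤ M on [0,t]: for every continuous χ vanishing
outside B(x₀, R − c t) and every 1-Lipschitz F bounded by 1, E₁ F(reduced fields of Φ_t z against χ)
− E₂ F(…) → 0. Intended proof: relay-race path counting (≤ 2^k chains), per-link conditional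
Palm–Gibbs bounds (flight-length exponential moments, short-gap bound, energy-share bound), Chernoff
by iterated conditioning, seeds/time-grid union bound, two-copy disagreement coupling
(doi:10.1214/aop/1176988728); equilibrium one-copy core = GibbsLightCone; macroscopic times via
mesoscale channel/crowding regularity of the true law (card M2) or a short-window matched-reference
transfer (M5). [deps: GibbsLightCone] [difficulty: XL] (why it might fail: Out of equilibrium at
macroscopic t the per-link Palm bounds are needed along the TRUE law: mesoscale channel/crowding
regularity (no empty ε-tubes of length ≫ ℓ, no crowding at scale ≪ ℓ) is sub-extensive, invisible to
the O(N) entropy budget and unproved; guards sit on nominal Euler fields only.) [MarchioroEtAl1978,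
ButtaEtAl2007, RazSims2009, NachtergaeleEtAl2008, Alexander1975, Ruelle1969, GeorgiiZessin1993,
doi:10.1214/aop/1176988728, Dorfman1999]
#3 GibbsLightCone (crux) — EQUILIBRIUM LIEB–ROBINSON BOUND FOR BILLIARD BALLS (card LR-G; the
engine's first rung, one copy, no coupling, no Euler data): for constant activity a > 0 and
temperature θ > 0 (zero drift) there are σ₀ > 0 and a cone speed c > 0 such that for every 0 < σ <
σ₀, every family of hard-sphere flows of N+1 spheres of diameter hsDiameter σ N on 𝕋³, every t ≥ 0
and δ > 0: under the global Gibbs law localGibbsLaw σ a 0 θ (invariant), the probability that SOME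
particle i and SOME j that is i itself or lies in the APST backward cluster of i over (0, t]
(`HardSphereFlow.backwardCluster`, the particles with a time-ordered collision chain into (i, t))
satisfy dist_𝕋³(x_j(0), x_i(t)) > c t + δ tends to 0 as N → ∞. Influence travels only along relay
chains whose span is a sum of flight lengths ≍ ℓ = (N+1)^(-1/3)/(√2πσ²); own displacements are
diffusive, O(N^(-1/6)). MD-testable (infection front radius linear in t, slope κ₁√θ, N- and
φ-independent at leading order). [difficulty: XL] (why it might fail: Focusing relays: the faster
outgoing sphere keeps ≥ ½ of the pair energy, so among the 2^k relay lineages some may sustain E ≫ θ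
and make ≫ νt links per unit time (span ∝ links × ℓ); needs a per-link energy-share bound P(U > 1−η
∣ past) ≤ Cη under Palm–Gibbs conditioning (audit T9).) [doi:10.1007/bf01645779, MarchioroEtAl1978,
RazSims2009, AokiPulvirentiSimonellaTsuji2015, PulvirentiSimonella2021, Alexander1975, Ruelle1969]
#4 NearConstantShortTimeHL (crux) — NEAR-CONSTANT SHORT-TIME HYDRODYNAMIC LIMIT for general
diameter/number families (foreign input; only C⁰-AMPLITUDE smallness δ₀(M) at t = 0 plus C¹ GUARDS M
on [0,t], because the flattened comparison profiles of ConeLocalisation have O(1) gradients): ∃ η₀ ∀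
M ∃ δ₀, τ₀ > 0 ∀ continuous positive profiles ∃ σ₀ ∀ σ < σ₀ ∀ families (ε_N → 0, n_N ε_N³ → σ³) ∀
classical hs-Euler solutions with |ρ(0) − 1|, |u(0) − ū|, |θ(0) − θ̄| ≤ δ₀ ∀ flows: if the canonical
local Gibbs laws are probability measures with LLN at 0, then for t < min(T, τ₀), provided packing <
η₀, θ ∈ [1/M, M], |u| ≤ M and all first Torus.partialDeriv ≤ M on [0,t], the three empirical fields
satisfy the LLN at t. [difficulty: open-problem] (why it might fail: It is the near-equilibrium
hydrodynamic limit at fixed σ (relaxation of shear/sound/heat modes of deterministic spheres), open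
even linearised (Spohn1991 §7.1 (7.13)–(7.18)), asked uniformly in M with C¹ guards only; one
O(1)-slow non-hydrodynamic mode kills it.) [Spohn1991, BGSSCPAM2023, OllaVaradhanYau1993, Doyon2022]
#5 RestartPrinciple (crux) — RESTART: the short-time guarded hydrodynamic limit S (∃ η₀ ∀ M ∃ τ₁ >
0: for every profile/σ/classical solution of the conjunct's family with LLN at 0, the LLN holds at
every t < min(T, τ₁) at which packing < η₀, ρ ≤ M, θ ∈ [1/M, M], |u| ≤ M and all Torus.partialDeriv
of (ρ,u,θ) up to order 3 are ≤ M on [0,t]) IMPLIES the packing-guarded conjunct (∃ η₀ ∀ profiles ∃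
σ₀ ∀ σ < σ₀ ∀ solutions with ρ_tσ³ < η₀ on [0,T), LLN at 0 ⇒ LLN at all t < T; body of
HydroLimitInBand, stmt-3093 — since the 2026-08-16 re-type (p126922) verbatim the sub-problem decl
`_root_.HydrodynamicLimit`, so this consequent IS the Statement). Content: a finite restart
induction with step τ₁(M(t)) along the given solution; the law at a restart time is not local Gibbs,
so S must be re-proved in a restartable currency (a propagated class of laws: LLN + mesoscale
regularity, or Liouville-pinned entropy). [deps: NearConstantShortTimeHL] [difficulty: XL] (why it
might fail: The time-τ₁ law is not local Gibbs: o(N) relative entropy transfers only e^(-cN)-rare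
events while cone/relaxation bounds are e^(-cN^(1/3))-rare; S must be re-proved for a propagated
class of laws (mesoscale regularity along the true law), unproved.) [Yau1991, OllaVaradhanYau1993,
KipnisLandim1999, Spohn1991]
#9 ConeLocalisation (support) — GLUE (small ⇒ large for short times): LightConeInLaw →
NearConstantShortTimeHL → S (S as in RestartPrinciple). Proof plan: given a profile with C³ bounds M
on [0,t] and x₀, flatten the Euler data outside B(x₀,2r) by a cutoff at scale r towards the constant
state (ρ(0,x₀), u(0,x₀), θ(0,x₀)) (amplitude ≤ C M r, gradients ≤ C M); realise it as gas 2 with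
n₂(N) = ⌈ρ(0,x₀)(N+1)⌉ spheres of the same diameter and a local Gibbs activity with LLN (static
input: low-density LLN + activity inversion for the comparison family, cluster expansion — rides as
`--supports` lemmas); its classical solution lives ≥ c/M (scaling + H³ local theory, Kato1975,
Majda1984) with C¹ norm ≤ C'M up to time r/c; Euler's domain of dependence identifies it with the
original solution inside the shrinking ball; the cone transfers the LLN for test functions supported
in B(x₀, r − c t), t ≤ τ₁ := min(τ₀(C'M), r/c(M)); a partition of unity over x₀ finishes.
[difficulty: L] [Kato1975, Majda1984, Sideris1985, Spohn1991, Rauch1986]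
(Dropped at rev 1, 2026-08-16: #9 DiluteSelfConsistency (support, shared
stmt-AtomisticToContinuum-3091) — it only removed the packing guard at the very end; after the
statement re-type p126922 the guard is a hypothesis of `_root_.HydrodynamicLimit`, so the item is
not load-bearing here; it keeps its other routes. The rev-0 Assembly stmt-12505, which consumed it,
is restated crux-only: #1 Assembly (assembly) — LightConeInLaw → NearConstantShortTimeHL →
RestartPrinciple → HydrodynamicLimit, i.e. X → Statement; content = ConeLocalisation + the two-line
logic of `closes`. [deps: ConeLocalisation] [difficulty: L])

TWO-LAYER PLAN. Foreseen glued splits (k ≤ 3, depth 1), nothing filed now: LightConeInLaw ⇐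
PalmLinkBounds (card M1: flight-length exponential moments,
short-gap bound, energy-share bound, uniformly in the chain's past σ-algebra under Palm–Gibbs — the
same bounds prove GibbsLightCone) →
NonEquilibriumTransfer (M2 mesoscale channel/crowding regularity along the true law + M5
short-window matched reference) → TwoCopyCoupling
(disagreement coupling of two canonical local Gibbs laws agreeing on a ball + "both backward
clusters avoid the disagreement set ⇒ equal
trajectories") → LightConeInLaw. GibbsLightCone ⇐ OwnDisplacement (diffusive, no vacuum channels
under Gibbs) → RelaySpan (path counting +
Chernoff, quantitative e^(-cδ/ℓ) tail) → GibbsLightCone. NearConstantShortTimeHL ⇐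
LinearisedRelaxation (Euler-scale projection onto the five
charges, Doyon2022 + Spohn1991 (7.18)) → SmallAmplitudeNonlinear → NearConstantShortTimeHL.
RestartPrinciple ⇐ PropagatedClass (S for a class
of laws closed under the dynamics for short times) → induction → RestartPrinciple.

KILL CRITERIA. ¬GibbsLightCone — an N-growing influence speed under Gibbs (MD infection front
accelerating like √log N, or an analytic focusing-relay lineage
with positive log-energy Biggins speed) — closes the route `refuted:GibbsLightCone`, retires the
card and with it every light-cone consumer
(hydrodynamic-projection-transplant crux A, loschmidt-forward crux L); file it as negative
knowledge. ¬LightConeInLaw with GibbsLightCone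
standing ⇒ the non-equilibrium transfer (M2) is false: pivot to equilibrium/short-window consumers
only (route re-targets nothing of the
conjunct: close `refuted:LightConeInLaw`). ¬NearConstantShortTimeHL (an O(1)-slow near-equilibrium
mode at fixed σ) kills this route and in
substance the conjunct — operator alarm, not a pivot. ¬RestartPrinciple alone ⇒ pivot: keep cone +
near-constant and re-target to S as a
conditional bridge. DiluteSelfConsistency (dropped at rev 1) is no longer load-bearing: the guarded
conjunct it used to un-guard IS the
Statement since the 2026-08-16 re-type, so its fate does not touch this route. HydrodynamicLimit
proved
elsewhere moots cruxes 4–5 but not the cones.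

NOT DECOMPOSED YET. The card's M1–M5 (layer-2 children above); the constants κ₁, c(M), the time grid
and the quantitative tail e^(-cδσ²(N+1)^(1/3)) (GibbsLightCone
is filed qualitatively, → 0 at fixed t, δ); the covariance corollary for Doyon's framework
(hydrodynamic-projection-transplant crux A =
GibbsLightCone + exponential clustering of G, Ruelle1969) — filed when that card is routed; the
two-copy equilibrium special case (the retired
route's EquilibriumLightCone, implied by LightConeInLaw) — dropped as an item, kept as the first
child of LightConeInLaw's split; the PDE lemmas
inside ConeLocalisation (H³ lifespan ≥ c/M by scaling, C¹ amplification over r/c, domain of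
dependence) and its static input (LLN + activity
inversion for comparison local Gibbs families) ride as `--supports` lemmas; drift ū ≠ 0 and
σ-uniformity of c in GibbsLightCone.

CHEAPEST FALSIFIER. (i) Redo audit T9's computation honestly: for the best-of-2^k relay lineages
with the flux-weighted impact-parameter law
(P(energy share U > 1 − η ∣ past) ≤ Cη), is the log-energy branching random walk's Biggins speed
negative (triage value
inf_s log(2/(s+1))/s ≈ −0.23)? A positive speed means sustained focusing relays, span ~ v_th²τ²/ℓ,
no N-independent c — GibbsLightCone dies.
(ii) Event-driven MD at φ = 0.05–0.2, N = 10⁵–10⁶, equilibrium: tag one sphere, propagate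
"infection" at collisions, histogram the front
radius: must be linear in t with slope κ√θ, φ-independent at leading order, front width O(ℓ log N)
(not run: plancard seat, no kit job).
(iii) Sanity, on paper: GibbsLightCone is trivially TRUE for the ideal gas at fixed N → ∞? No —
without collisions the backward clusters
are empty but the own-displacement clause j = i fails (Maxwellian speeds > c + δ/t have
N-independent positive density): the statement has
teeth exactly through ℓ → 0; and LightConeInLaw is FALSE for the ideal gas (free streaming carries
disagreement inside any cone) — both as
they must be.

NUMBERS. Mean free path ℓ = (√2 π (N+1) ε²)⁻¹ = (N+1)^(-1/3)/(√2πσ²) (macroscopic units); collisions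
per particle per unit time ≍ √θ σ²(N+1)^(1/3);
own displacement over time t ≍ (ℓ v_th t)^(1/2) ≍ N^(-1/6); backward-cluster cardinality at fixed
density ≍ e^(C N^(1/3) t) (so only its
span, not its size, can be bounded; APST/PS bound the size in the Boltzmann–Grad regime); cone
overshoot δ costs e^(-cδ/ℓ) =
e^(-c√2πσ²δ(N+1)^(1/3)) against ≤ (N+1)² pairs × poly(N) time grid; predicted c(M) = M + κ₁√M with
κ₁ = O(1) from the Chernoff–entropy
balance against log 2 per link; dilute hs sound speed √(5θ/3)(1 + O(φ)) < κ₁√θ needed for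
consistency with Euler's domain of dependence;
reaction–diffusion heuristic for the infection front 2√(Dν) = 2√(ℓv_th · v_th/ℓ) = 2 v_th (ℓ
cancels); Biggins speed of the focusing lineage
BRW −0.23 (audit T9). Items at open: 7; after the rev-1 repair (2026-08-16): 6 (4 cruxes +
ConeLocalisation + the restated Assembly).

DEFINITION REQUESTS. None for the typed items: all seven decls elaborate over HardSphereEuler.lean /
HardSphereDynamics.lean / TorusCalculus.lean /
KineticTheory/BackwardCluster.lean (extra import). Deferred to the split of LightConeInLaw: a
two-copy disagreement set / matched coupling of
two `HardSphereFlow` trajectories with different particle numbers (topic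
Summits/AtomisticToContinuum/HydrodynamicLimit/Theorems); the Palm
kernel of the contact point process under `canonicalDensity` (Literature/Probability); cite fact:
GNZ (Georgii–Nguyen–Zessin) equations for
hard-core Gibbs point processes (GeorgiiZessin1993).

Novelty: Searches (2026-08-15): `lit frontier AtomisticToContinuum --since 2020` (30 rows; nothing on
locality / propagation bounds for hard spheres; nearest arXiv:2310.13338, heat equation from a
deterministic dynamics — other model); `lit bridges AtomisticToContinuum --cross any` (30 rows, none
on Lieb–Robinson bounds or hard-sphere locality); `lit galaxy search "Lieb-Robinson bound classical
hard sphere gas" --star all`, `"Lieb-Robinson bounds for classical"`, `"propagation of perturbations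
in a hard sphere"`, `"speed of propagation in the hard sphere gas"` (0 hits each), `"backward
cluster" --star all` (16 rows: AokiPulvirentiSimonellaTsuji2015 pdf + noise); `lit search --source
crossref "Lieb-Robinson bounds classical particle systems"` (12: quantum-lattice surveys,
doi:10.4249/scholarpedia.31267), `… "propagation of chaos front speed perturbation hard sphere gas
Lyapunov clock model"` (10: doi:10.1103/physreve.55.r9 Dellago–Posch, doi:10.1063/1.1701576
Ranganathan–Nelkin kinetic density disturbances), `… "largest Lyapunov exponent many particle
systems low densities clock model front"` (8: doi:10.1103/physrevlett.80.2035 van Zon–van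
Beijeren–Dellago: perturbation front in collision-count (clock) space, dilute regime, non-rigorous),
`… "epidemic spreading mobile agents collisions front propagation velocity"` (8: mobile-agent SIS
fronts, doi:10.1016/j.physa.2008.12.014); local index / OpenAlex / arXiv unavailable this session
(searchd rc 75, HTTP 429, 0 rows) — noted in NOTES.md;  [refs: 10.4249/scholarpedia.31267, 10.1103/physreve.55.r9, 10.1063/1.1701576, 10.1103/physrevlett.80.2035, 10.1016/j.physa.2008.12.014, 10.1007/bf01645779, 10.1214/aop/1176988728, 2310.13338, doi:10.4249/scholarpedia.31267, doi:10.1103/physreve.55.r9, doi:10.1063/1.1701576, doi:10.1103/physrevlett.80.2035, doi:10.1016/j.physa.2008.12.014, doi:10.1007/bf01645779, doi:10.1214/aop/1176988728, AokiPulvirenti]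

Barriers (technique_class: lieb-robinson path-counting palm-gibbs locality): - technique_class: lieb-robinson path-counting palm-gibbs locality
- Literature.Barriers.AtomisticToContinuum.HighMomentumCutoffBarrier: sidestepped for the cones —
spans are counted in flight LENGTHS, so Maxwellian tails enter only polynomial prefactors (pairs ×
time grid) against e^(-cδσ²N^(1/3)); no exponential velocity moment along f_t is used; the residual
velocity issue is the one-collision energy-share bound on relays.
- Literature.Barriers.AtomisticToContinuum.HighMomentumCutoffBarrierNarrow: not met — no time
derivative of a relative entropy is taken anywhere in this route.
- Literature.Barriers.AtomisticToContinuum.BoltzmannHypothesisBarrier: not in class for the cones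
(no closure, no stationary-state classification); it bites only inside NearConstantShortTimeHL,
where the bet is near-GLOBAL-equilibrium relaxation (linear response / projection onto the five
charges), and the ideal-gas kernel is respected: GibbsLightCone's displacement clause and
LightConeInLaw are false for free flight, as they must be.
- Literature.Barriers.AtomisticToContinuum.MacroErgodicityBarrier: not met — no infinite-volume
invariant-measure classification; time iteration is posed as RestartPrinciple (finite N, finite
time), whose stated failure mode is mesoscale regularity, not ergodicity.
- Literature.Barriers.AtomisticToContinuum.DiluteRegimeBarrier: not met — σ is fixed; low density
enters only through static Palm/cluster bounds (packing < η₀ guard) and ℓ/ε ≍ σ⁻³ ≫ 1; no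
Boltzmann–Grad li

History (route lifecycle, newest last):
- 2026-08-16T23:16:03Z · rev 1: restated Assembly (stmt-AtomisticToContinuum-12505 proved) — route-repair (statement-revised p126922, retype hydro2): the re-typed packing-guarded `_root_.HydrodynamicLimit` is verbatim the consequent of RestartPrinciple, (planner-rrepair-AtomisticToContinuum-RelayRace-c5073d1d-0)
- 2026-08-16T23:16:03Z · rev 1: dropped DiluteSelfConsistency — route-repair (statement-revised p126922, retype hydro2): the re-typed packing-guarded `_root_.HydrodynamicLimit` is verbatim the consequent of RestartPrinciple, (planner-rrepair-AtomisticToContinuum-RelayRace-c5073d1d-0)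
- 2026-08-24T06:29:56Z · DORMANT — reconciler: no traction for 6.6 d (last activity item-evidence-added at 2026-08-17T16:00:57Z); parked, not closed — `ledger route dormant route-AtomisticToConti (operator:999:3705665)

sub-problem: HydrodynamicLimit · status: dormant · opened planner-plancard-AtomisticToContinuum-Hydrody-e9122d9c-g2-0 2026-08-15T18:55:13Z · rev 3 · ledger route-AtomisticToContinuum-RelayRaceLocality
GENERATED by the gate from the ledger (D-0016/17). Provers cite these decls: `theorem foo : Summit.AtomisticToContinuum.HydrodynamicLimit.Theses.RelayRaceLocality.<Decl> := …` in Summits/AtomisticToContinuum/HydrodynamicLimit/Theorems/<Name>.lean.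
-/

namespace Summit.AtomisticToContinuum.HydrodynamicLimit.Theses.RelayRaceLocality

open scoped BigOperators Topology Manifold Classical MeasureTheory ProbabilityTheory Matrix InnerProductSpace ComplexConjugate ContinuousMap
open Filter Set Function TopologicalSpace MeasureTheory

attribute [summit_statement] _root_.HydrodynamicLimit

/-- item stmt-AtomisticToContinuum-12500 · crux · rank 2 · open · by planner
why it might fail: Out of equilibrium at macroscopic t the per-link Palm bounds are needed along the TRUE law: mesoscale channel/crowding regularity (no empty ε-tubes of length ≫ ℓ, no crowding at scale ≪ ℓ) is sub-extensive, invisible to the O(N) entropy budget and unproved; guards sit on nominal Euler fields only.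
sources: MarchioroEtAl1978, ButtaEtAl2007, RazSims2009, NachtergaeleEtAl2008, Alexander1975, Ruelle1969
[crux] LIGHT CONE IN LAW (card LR-G/M1–M5, two-copy form): ∃ η₀ ∀ M ∃ c > 0 such that for two
hard-sphere gases on 𝕋³ with the SAME diameter hsDiameter σ₁ N — gas 1 the conjunct's (N+1 spheres,
local Gibbs profile (a₁,u₁,θ₁)), gas 2 any comparison gas (n₂(N) spheres, n₂ε³ → σ₂³, local Gibbs
profile (a₂,u₂,θ₂)) — whose laws are probability measures with LLN at t = 0 towards classical
hs-Euler data that AGREE on B(x₀,R) in reduced units (ρσ³, u, θ) and whose nominal fields obey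
packing < η₀, θ ≤ M, |u| ≤ M on [0,t]: for every continuous χ vanishing outside B(x₀, R − c t) and
every 1-Lipschitz F bounded by 1, E₁ F(reduced fields of Φ_t z against χ) − E₂ F(…) → 0. Intended
proof: relay-race path counting (≤ 2^k chains), per-link conditional Palm–Gibbs bounds
(flight-length exponential moments, short-gap bound, energy-share bound), Chernoff by iterated
conditioning, seeds/time-grid union bound, two-copy disagreement coupling
(doi:10.1214/aop/1176988728); equilibrium one-copy core = GibbsLightCone; macroscopic times via
mesoscale channel/crowding regularity of the true law (card M2) or a short-window matched-reference
transfer (M5). [deps: GibbsLightCone] [difficulty: XL] -/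
@[route_item "route-AtomisticToContinuum-RelayRaceLocality", crux]
def LightConeInLaw : Prop :=
  open Literature.MathematicalPhysics.KineticTheory Literature.Analysis.FluidPDE MeasureTheory Filter in ∃ η₀ : ℝ, 0 < η₀ ∧ ∀ M : ℝ, 0 < M → ∃ c : ℝ, 0 < c ∧ ∀ (a₁ θ₁ a₂ θ₂ : T3 → ℝ) (u₁ u₂ : T3 → V3), Continuous a₁ → Continuous θ₁ → Continuous u₁ → Continuous a₂ → Continuous θ₂ → Continuous u₂ → (∀ x, 0 < a₁ x) → (∀ x, 0 < θ₁ x) → (∀ x, 0 < a₂ x) → (∀ x, 0 < θ₂ x) → ∃ σ₀ : ℝ, 0 < σ₀ ∧ ∀ (σ₁ σ₂ : ℝ), 0 < σ₁ → σ₁ < σ₀ → 0 < σ₂ → σ₂ < σ₀ → ∀ n₂ : ℕ → ℕ, Tendsto (fun N => (n₂ N : ℝ) * hsDiameter σ₁ N ^ 3) atTop (nhds (σ₂ ^ 3)) → ∀ (T₁ T₂ : ℝ) (ρ₁ Θ₁ ρ₂ Θ₂ : ℝ → T3 → ℝ) (U₁ U₂ : ℝ → T3 → V3), IsHardSphereEulerSolution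 σ₁ T₁ ρ₁ U₁ Θ₁ → IsHardSphereEulerSolution σ₂ T₂ ρ₂ U₂ Θ₂ → ∀ (Φ₁ : (N : ℕ) → HardSphereFlow (Torus.geometry (Fin 3)) (hsDiameter σ₁ N) (N + 1)) (Φ₂ : (N : ℕ) → HardSphereFlow (Torus.geometry (Fin 3)) (hsDiameter σ₁ N) (n₂ N)), let P₁ : (N : ℕ) → Measure (Config (N + 1) (Fin 3) T3) := fun N => localGibbsLaw σ₁ a₁ u₁ θ₁ N (Φ₁ N); let P₂ : (N : ℕ) → Measure (Config (n₂ N) (Fin 3) T3) := fun N => particleLaw (Φ₂ N) (canonicalDensity (Torus.geometry (Fin 3)) (hsDiameter σ₁ N) (n₂ N) (localGibbsProfile a₂ u₂ θ₂)); (∀ N, IsProbabilityMeasure (P₁ N)) → (∀ N, IsProbabilityMeasure (P₂ N)) → TendstoHydroFieldsAt P₁ Φ₁ ρ₁ U₁ Θ₁ 0 → (∀ χ : T3 → ℝ, Continuous χ → ∀ δ : ℝ, 0 < δ → Tendsto (fun N => P₂ N {z | δ < |empiricalDensityField ((Φ₂ N).flow 0 z) χ - ∫ x, χ x * ρ₂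 0 x|}) atTop (nhds 0) ∧ Tendsto (fun N => P₂ N {z | δ < ‖empiricalMomentumField ((Φ₂ N).flow 0 z) χ - ∫ x, (χ x * ρ₂ 0 x) • U₂ 0 x‖}) atTop (nhds 0) ∧ Tendsto (fun N => P₂ N {z | δ < |empiricalEnergyField ((Φ₂ N).flow 0 z) χ - ∫ x, χ x * totalEnergyDensity (ρ₂ 0 x) (U₂ 0 x) (Θ₂ 0 x)|}) atTop (nhds 0)) → ∀ t : ℝ, 0 ≤ t → t < T₁ → t < T₂ → (∀ s ∈ Set.Icc 0 t, ∀ x, ρ₁ s x * σ₁ ^ 3 < η₀ ∧ Θ₁ s x ≤ M ∧ ‖U₁ s x‖ ≤ M ∧ ρ₂ s x * σ₂ ^ 3 < η₀ ∧ Θ₂ s x ≤ M ∧ ‖U₂ s x‖ ≤ M) → ∀ (x₀ : T3) (R : ℝ), (∀ x, Torus.euclidDist x x₀ < R → ρ₁ 0 x * σ₁ ^ 3 = ρ₂ 0 x * σ₂ ^ 3 ∧ U₁ 0 x = U₂ 0 x ∧ Θ₁ 0 x = Θ₂ 0 x) → ∀ χ : T3 → ℝ, Continuous χ → (∀ x,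 R - c * t ≤ Torus.euclidDist x x₀ → χ x = 0) → ∀ F : ℝ × V3 × ℝ → ℝ, LipschitzWith 1 F → (∀ p, |F p| ≤ 1) → Tendsto (fun N => (∫ z, F (σ₁ ^ 3 * empiricalDensityField ((Φ₁ N).flow t z) χ, (σ₁ ^ 3) • empiricalMomentumField ((Φ₁ N).flow t z) χ, σ₁ ^ 3 * empiricalEnergyField ((Φ₁ N).flow t z) χ) ∂(P₁ N)) - ∫ z, F (σ₂ ^ 3 * empiricalDensityField ((Φ₂ N).flow t z) χ, (σ₂ ^ 3) • empiricalMomentumField ((Φ₂ N).flow t z) χ, σ₂ ^ 3 * empiricalEnergyField ((Φ₂ N).flow t z) χ) ∂(P₂ N)) atTop (nhds 0)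

/-- item stmt-AtomisticToContinuum-12501 · crux · rank 3 · open · by planner
why it might fail: Focusing relays: the faster outgoing sphere keeps ≥ ½ of the pair energy, so among the 2^k relay lineages some may sustain E ≫ θ and make ≫ νt links per unit time (span ∝ links × ℓ); needs a per-link energy-share bound P(U > 1−η ∣ past) ≤ Cη under Palm–Gibbs conditioning (audit T9).
sources: doi:10.1007/bf01645779, MarchioroEtAl1978, RazSims2009, AokiPulvirentiSimonellaTsuji2015, PulvirentiSimonella2021, Alexander1975
[crux] EQUILIBRIUM LIEB–ROBINSON BOUND FOR BILLIARD BALLS (card LR-G; the engine's first rung, one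
copy, no coupling, no Euler data): for constant activity a > 0 and temperature θ > 0 (zero drift)
there are σ₀ > 0 and a cone speed c > 0 such that for every 0 < σ < σ₀, every family of hard-sphere
flows of N+1 spheres of diameter hsDiameter σ N on 𝕋³, every t ≥ 0 and δ > 0: under the global Gibbs
law localGibbsLaw σ a 0 θ (invariant), the probability that SOME particle i and SOME j that is i
itself or lies in the APST backward cluster of i over (0, t] (`HardSphereFlow.backwardCluster`, the
particles with a time-ordered collision chain into (i, t)) satisfy dist_𝕋³(x_j(0), x_i(t)) > c t + δ
tends to 0 as N → ∞. Influence travels only along relay chains whose span is a sum of flight lengths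
≍ ℓ = (N+1)^(-1/3)/(√2πσ²); own displacements are diffusive, O(N^(-1/6)). MD-testable (infection
front radius linear in t, slope κ₁√θ, N- and φ-independent at leading order). [difficulty: XL] -/
@[route_item "route-AtomisticToContinuum-RelayRaceLocality", crux]
def GibbsLightCone : Prop :=
  open Literature.MathematicalPhysics.KineticTheory Literature.Analysis.FluidPDE MeasureTheory Filter in ∀ a θ : ℝ, 0 < a → 0 < θ → ∃ σ₀ : ℝ, 0 < σ₀ ∧ ∃ c : ℝ, 0 < c ∧ ∀ σ : ℝ, 0 < σ → σ < σ₀ → ∀ Φ : (N : ℕ) → HardSphereFlow (Torus.geometry (Fin 3)) (hsDiameter σ N) (N + 1), ∀ t : ℝ, 0 ≤ t → ∀ δ : ℝ, 0 < δ → Tendsto (fun N => localGibbsLaw σ (fun _ => a) (fun _ => 0) (fun _ => θ) N (Φ N) {z | ∃ i j : Fin (N + 1), (j = i ∨ j ∈ (Φ N).backwardCluster i 0 t z) ∧ c * t + δ < Torus.euclidDist (z j).1 ((Φ N).flow t z i).1}) atTop (nhds 0)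

/-- item stmt-AtomisticToContinuum-12502 · crux · rank 4 · open · by planner
why it might fail: It is the near-equilibrium hydrodynamic limit at fixed σ (relaxation of shear/sound/heat modes of deterministic spheres), open even linearised (Spohn1991 §7.1 (7.13)–(7.18)), asked uniformly in M with C¹ guards only; one O(1)-slow non-hydrodynamic mode kills it.
sources: Spohn1991, BGSSCPAM2023, OllaVaradhanYau1993, Doyon2022
[crux] NEAR-CONSTANT SHORT-TIME HYDRODYNAMIC LIMIT for general diameter/number families (foreign
input; only C⁰-AMPLITUDE smallness δ₀(M) at t = 0 plus C¹ GUARDS M on [0,t], because the flattened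
comparison profiles of ConeLocalisation have O(1) gradients): ∃ η₀ ∀ M ∃ δ₀, τ₀ > 0 ∀ continuous
positive profiles ∃ σ₀ ∀ σ < σ₀ ∀ families (ε_N → 0, n_N ε_N³ → σ³) ∀ classical hs-Euler solutions
with |ρ(0) − 1|, |u(0) − ū|, |θ(0) − θ̄| ≤ δ₀ ∀ flows: if the canonical local Gibbs laws are
probability measures with LLN at 0, then for t < min(T, τ₀), provided packing < η₀, θ ∈ [1/M, M],
|u| ≤ M and all first Torus.partialDeriv ≤ M on [0,t], the three empirical fields satisfy the LLN at
t. [difficulty: open-problem] -/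
@[route_item "route-AtomisticToContinuum-RelayRaceLocality", crux]
def NearConstantShortTimeHL : Prop :=
  open Literature.MathematicalPhysics.KineticTheory Literature.Analysis.FluidPDE Literature.Analysis.FunctionSpaces MeasureTheory Filter in ∃ η₀ : ℝ, 0 < η₀ ∧ ∀ M : ℝ, 0 < M → ∃ δ₀ : ℝ, 0 < δ₀ ∧ ∃ τ₀ : ℝ, 0 < τ₀ ∧ ∀ (a₀ θ₀ : T3 → ℝ) (u₀ : T3 → V3), Continuous a₀ → Continuous θ₀ → Continuous u₀ → (∀ x, 0 < a₀ x) → (∀ x, 0 < θ₀ x) → ∃ σ₀ : ℝ, 0 < σ₀ ∧ ∀ σ : ℝ, 0 < σ → σ < σ₀ → ∀ (ε : ℕ → ℝ) (n : ℕ → ℕ), (∀ N, 0 < ε N) → Tendsto ε atTop (nhds 0) → Tendsto (fun N => (n N : ℝ) * ε N ^ 3) atTop (nhds (σ ^ 3)) → ∀ (T : ℝ) (ρ θ : ℝ → T3 → ℝ) (u : ℝ → T3 → V3), IsHardSphereEulerSolution σ T ρ u θ → (∃ (ubar : V3) (θbar : ℝ), ∀ x, |ρ 0 x - 1| ≤ δ₀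 ∧ ‖u 0 x - ubar‖ ≤ δ₀ ∧ |θ 0 x - θbar| ≤ δ₀) → ∀ Φ : (N : ℕ) → HardSphereFlow (Torus.geometry (Fin 3)) (ε N) (n N), let P : (N : ℕ) → Measure (Config (n N) (Fin 3) T3) := fun N => particleLaw (Φ N) (canonicalDensity (Torus.geometry (Fin 3)) (ε N) (n N) (localGibbsProfile a₀ u₀ θ₀)); (∀ N, IsProbabilityMeasure (P N)) → (∀ χ : T3 → ℝ, Continuous χ → ∀ δ : ℝ, 0 < δ → Tendsto (fun N => P N {z | δ < |empiricalDensityField ((Φ N).flow 0 z) χ - ∫ x, χ x * ρ 0 x|}) atTop (nhds 0) ∧ Tendsto (fun N => P N {z | δ < ‖empiricalMomentumField ((Φ N).flow 0 z) χ - ∫ x, (χ x * ρ 0 x) • u 0 x‖}) atTop (nhds 0) ∧ Tendsto (fun N => P N {z | δ < |empiricalEnergyField ((Φ N).flow 0 z) χ - ∫ x, χ x * totalEnergyDensity (ρ 0 x) (u 0 x) (θ 0 x)|}) atTop (nhds 0)) → ∀ t ∈ Set.Ico 0 (min T τ₀), (∀ s ∈ Set.Icc 0 t, ∀ x, ρ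 s x * σ ^ 3 < η₀ ∧ θ s x ≤ M ∧ M⁻¹ ≤ θ s x ∧ ‖u s x‖ ≤ M ∧ ∀ i : Fin 3, |Torus.partialDeriv i (ρ s) x| ≤ M ∧ ‖Torus.partialDeriv i (u s) x‖ ≤ M ∧ |Torus.partialDeriv i (θ s) x| ≤ M) → ∀ χ : T3 → ℝ, Continuous χ → ∀ δ : ℝ, 0 < δ → Tendsto (fun N => P N {z | δ < |empiricalDensityField ((Φ N).flow t z) χ - ∫ x, χ x * ρ t x|}) atTop (nhds 0) ∧ Tendsto (fun N => P N {z | δ < ‖empiricalMomentumField ((Φ N).flow t z) χ - ∫ x, (χ x * ρ t x) • u t x‖}) atTop (nhds 0) ∧ Tendsto (fun N => P N {z | δ < |empiricalEnergyField ((Φ N).flow t z) χ - ∫ x, χ x * totalEnergyDensity (ρ t x) (u t x) (θ t x)|}) atTop (nhds 0)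

/-- item stmt-AtomisticToContinuum-12503 · crux · rank 5 · open · by planner
why it might fail: The time-τ₁ law is not local Gibbs: o(N) relative entropy transfers only e^(-cN)-rare events while cone/relaxation bounds are e^(-cN^(1/3))-rare; S must be re-proved for a propagated class of laws (mesoscale regularity along the true law), unproved.
sources: Yau1991, OllaVaradhanYau1993, KipnisLandim1999, Spohn1991
[crux] RESTART: the short-time guarded hydrodynamic limit S (∃ η₀ ∀ M ∃ τ₁ > 0: for every
profile/σ/classical solution of the conjunct's family with LLN at 0, the LLN holds at every t <
min(T, τ₁) at which packing < η₀, ρ ≤ M, θ ∈ [1/M, M], |u| ≤ M and all Torus.partialDeriv of (ρ,u,θ)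
up to order 3 are ≤ M on [0,t]) IMPLIES the packing-guarded conjunct (∃ η₀ ∀ profiles ∃ σ₀ ∀ σ < σ₀
∀ solutions with ρ_tσ³ < η₀ on [0,T), LLN at 0 ⇒ LLN at all t < T; body of HydroLimitInBand,
stmt-3093). Content: a finite restart induction with step τ₁(M(t)) along the given solution; the law
at a restart time is not local Gibbs, so S must be re-proved in a restartable currency (a propagated
class of laws: LLN + mesoscale regularity, or Liouville-pinned entropy). [deps:
NearConstantShortTimeHL] [difficulty: XL] -/
@[route_item "route-AtomisticToContinuum-RelayRaceLocality", crux]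
def RestartPrinciple : Prop :=
  open Literature.MathematicalPhysics.KineticTheory Literature.Analysis.FluidPDE Literature.Analysis.FunctionSpaces MeasureTheory Filter in (∃ η₀ : ℝ, 0 < η₀ ∧ ∀ M : ℝ, 0 < M → ∃ τ₁ : ℝ, 0 < τ₁ ∧ ∀ (a₀ θ₀ : T3 → ℝ) (u₀ : T3 → V3), Continuous a₀ → Continuous θ₀ → Continuous u₀ → (∀ x, 0 < a₀ x) → (∀ x, 0 < θ₀ x) → ∃ σ₀ : ℝ, 0 < σ₀ ∧ ∀ σ : ℝ, 0 < σ → σ < σ₀ → ∀ (T : ℝ) (ρ θ : ℝ → T3 → ℝ) (u : ℝ → T3 → V3), IsHardSphereEulerSolution σ T ρ u θ → ∀ Φ : (N : ℕ) → HardSphereFlow (Torus.geometry (Fin 3)) (hsDiameter σ N) (N + 1), TendstoHydroFieldsAt (fun N => localGibbsLaw σ a₀ u₀ θ₀ N (Φ N)) Φ ρ u θ 0 → ∀ t ∈ Set.Ico 0 (min T τ₁), (∀ s ∈ Set.Icc 0 t, ∀ x, ρ s x * σ ^ 3 < η₀ ∧ ρ s x ≤ M ∧ θ s x ≤ M ∧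 M⁻¹ ≤ θ s x ∧ ‖u s x‖ ≤ M ∧ ∀ i j k : Fin 3, |Torus.partialDeriv i (ρ s) x| ≤ M ∧ ‖Torus.partialDeriv i (u s) x‖ ≤ M ∧ |Torus.partialDeriv i (θ s) x| ≤ M ∧ |Torus.partialDeriv i (Torus.partialDeriv j (ρ s)) x| ≤ M ∧ ‖Torus.partialDeriv i (Torus.partialDeriv j (u s)) x‖ ≤ M ∧ |Torus.partialDeriv i (Torus.partialDeriv j (θ s)) x| ≤ M ∧ |Torus.partialDeriv i (Torus.partialDeriv j (Torus.partialDeriv k (ρ s))) x| ≤ M ∧ ‖Torus.partialDeriv i (Torus.partialDeriv j (Torus.partialDeriv k (u s))) x‖ ≤ M ∧ |Torus.partialDeriv i (Torus.partialDeriv j (Torus.partialDeriv k (θ s))) x| ≤ M) → TendstoHydroFieldsAt (fun N => localGibbsLaw σ a₀ u₀ θ₀ N (Φ N)) Φ ρ u θ t) → (∃ η₀ : ℝ, 0 < η₀ ∧ ∀ (a₀ θ₀ : T3 → ℝ) (u₀ : T3 → V3), Continuous a₀ → Continuous θ₀ → Continuous u₀ → (∀ x, 0 < a₀ x) → (∀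 x, 0 < θ₀ x) → ∃ σ₀ : ℝ, 0 < σ₀ ∧ ∀ σ : ℝ, 0 < σ → σ < σ₀ → ∀ (T : ℝ) (ρ θ : ℝ → T3 → ℝ) (u : ℝ → T3 → V3), IsHardSphereEulerSolution σ T ρ u θ → (∀ t ∈ Set.Ico 0 T, ∀ x, ρ t x * σ ^ 3 < η₀) → ∀ Φ : (N : ℕ) → HardSphereFlow (Torus.geometry (Fin 3)) (hsDiameter σ N) (N + 1), TendstoHydroFieldsAt (fun N => localGibbsLaw σ a₀ u₀ θ₀ N (Φ N)) Φ ρ u θ 0 → ∀ t ∈ Set.Ico 0 T, TendstoHydroFieldsAt (fun N => localGibbsLaw σ a₀ u₀ θ₀ N (Φ N)) Φ ρ u θ t)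

/-- item stmt-AtomisticToContinuum-12504 · crux · rank 9 · open · by planner
why it might fail: ∃σ₀ in LightConeInLaw/NearConstantShortTimeHL is per comparison profile, but the flattened family depends on x₀, r(M) and, via the canonical normalisation λ(σ) fixing n₂/(N+1), on σ; static LLN + activity inversion for general (ε,n) canonical families is in-tree only for (N+1, hsDiameter σ N).
sources: Kato1975, Majda1984, Sideris1985, Spohn1991, Rauch1986
[support] GLUE (small ⇒ large for short times): LightConeInLaw → NearConstantShortTimeHL → S (S as
in RestartPrinciple). Proof plan: given a profile with C³ bounds M on [0,t] and x₀, flatten the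
Euler data outside B(x₀,2r) by a cutoff at scale r towards the constant state (ρ(0,x₀), u(0,x₀),
θ(0,x₀)) (amplitude ≤ C M r, gradients ≤ C M); realise it as gas 2 with n₂(N) = ⌈ρ(0,x₀)(N+1)⌉
spheres of the same diameter and a local Gibbs activity with LLN (static input: low-density LLN +
activity inversion for the comparison family, cluster expansion — rides as `--supports` lemmas); its
classical solution lives ≥ c/M (scaling + H³ local theory, Kato1975, Majda1984) with C¹ norm ≤ C'M
up to time r/c; Euler's domain of dependence identifies it with the original solution inside the
shrinking ball; the cone transfers the LLN for test functions supported in B(x₀, r − c t), t ≤ τ₁ :=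
min(τ₀(C'M), r/c(M)); a partition of unity over x₀ finishes. [difficulty: L] -/
@[route_item "route-AtomisticToContinuum-RelayRaceLocality", crux]
def ConeLocalisation : Prop :=
  open Literature.MathematicalPhysics.KineticTheory Literature.Analysis.FluidPDE Literature.Analysis.FunctionSpaces MeasureTheory Filter in LightConeInLaw → NearConstantShortTimeHL → (∃ η₀ : ℝ, 0 < η₀ ∧ ∀ M : ℝ, 0 < M → ∃ τ₁ : ℝ, 0 < τ₁ ∧ ∀ (a₀ θ₀ : T3 → ℝ) (u₀ : T3 → V3), Continuous a₀ → Continuous θ₀ → Continuous u₀ → (∀ x, 0 < a₀ x) → (∀ x, 0 < θ₀ x) → ∃ σ₀ : ℝ, 0 < σ₀ ∧ ∀ σ : ℝ, 0 < σ → σ < σ₀ → ∀ (T : ℝ) (ρ θ : ℝ → T3 → ℝ) (u : ℝ → T3 → V3), IsHardSphereEulerSolution σ T ρ u θ → ∀ Φ : (N : ℕ) → HardSphereFlow (Torus.geometry (Fin 3)) (hsDiameter σ N) (N + 1), TendstoHydroFieldsAt (fun N => localGibbsLaw σ a₀ u₀ θ₀ N (Φ N)) Φ ρ u θ 0 → ∀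 t ∈ Set.Ico 0 (min T τ₁), (∀ s ∈ Set.Icc 0 t, ∀ x, ρ s x * σ ^ 3 < η₀ ∧ ρ s x ≤ M ∧ θ s x ≤ M ∧ M⁻¹ ≤ θ s x ∧ ‖u s x‖ ≤ M ∧ ∀ i j k : Fin 3, |Torus.partialDeriv i (ρ s) x| ≤ M ∧ ‖Torus.partialDeriv i (u s) x‖ ≤ M ∧ |Torus.partialDeriv i (θ s) x| ≤ M ∧ |Torus.partialDeriv i (Torus.partialDeriv j (ρ s)) x| ≤ M ∧ ‖Torus.partialDeriv i (Torus.partialDeriv j (u s)) x‖ ≤ M ∧ |Torus.partialDeriv i (Torus.partialDeriv j (θ s)) x| ≤ M ∧ |Torus.partialDeriv i (Torus.partialDeriv j (Torus.partialDeriv k (ρ s))) x| ≤ M ∧ ‖Torus.partialDeriv i (Torus.partialDeriv j (Torus.partialDeriv k (u s))) x‖ ≤ M ∧ |Torus.partialDeriv i (Torus.partialDeriv j (Torus.partialDeriv k (θ s))) x| ≤ M) → TendstoHydroFieldsAt (fun N => localGibbsLaw σ a₀ u₀ θ₀ N (Φ N)) Φ ρ u θ t)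

-- earlier Assembly (stmt-AtomisticToContinuum-12505, replaced 2026-08-16T23:16:03Z -> stmt-AtomisticToContinuum-17333): proved by Summit.AtomisticToContinuum.HydrodynamicLimit.Theorems.relayRaceLocality_assembly_proof @ 3df8881cdf11 — LightConeInLaw → NearConstantShortTimeHL → ConeLocalisation → RestartPrinciple → DiluteSelfConsistency → _root_.HydrodynamicLimit
/-- item stmt-AtomisticToContinuum-17333 · assembly · rank 1 · open · by planner
sources: Spohn1991, OllaVaradhanYau1993
[assembly] X → HydrodynamicLimit for the thesis X = LightConeInLaw ∧ NearConstantShortTimeHL ∧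
RestartPrinciple: the three ranked cruxes of X alone imply the (re-typed 2026-08-16,
packing-guarded) conjunct `_root_.HydrodynamicLimit`. Not pure logic (restated 2026-08-16 by
route-repair after the statement re-type p126922 made the rev-0 form `LightConeInLaw →
NearConstantShortTimeHL → ConeLocalisation → RestartPrinciple → DiluteSelfConsistency →
HydrodynamicLimit` — stmt-12505, proved against the OLD unguarded statement — obsolete,
DiluteSelfConsistency being dropped from the route): it packages the support ConeLocalisation
(stmt-AtomisticToContinuum-12504: cone + near-constant theorem ⇒ the short-time guarded limit S by
flattening outside a ball and Euler's domain of dependence) — prove that first, then `fun h₂ h₃ h₄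
=> h₄ (cone h₂ h₃)` since RestartPrinciple's consequent is the Statement verbatim; a direct proof
bypassing the item is equally welcome. `closes` (which takes ConeLocalisation as a hypothesis) stays
the deciding theorem. [deps: ConeLocalisation] [difficulty: L] -/
@[route_item "route-AtomisticToContinuum-RelayRaceLocality", crux]
def Assembly : Prop :=
  LightConeInLaw → NearConstantShortTimeHL → RestartPrinciple → _root_.HydrodynamicLimit

/-! D-0027 §2.1 — DECIDING THEOREM (planner-authored via `route open/edit --closes-file`; by planner-rbadge-AtomisticToContinuum-RelayRaceL-49cf521d-0 2026-08-16T23:44:20Z):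
its hypotheses are this route's items and its conclusion the sub-problem Statement (glue_lint), and it elaborates with this file. -/

/-- Deciding theorem (re-certified 2026-08-16, route-repair rev 3; proof term unchanged from rev 1).
The sub-problem decl `_root_.HydrodynamicLimit` (packing-guarded `d = 3` hard-sphere Euler limit,
statement re-type p126922) is verbatim the consequent of `RestartPrinciple`; `ConeLocalisation`
(a crux since rev 2, so every hypothesis here is a crux item) applied to `LightConeInLaw` and
`NearConstantShortTimeHL` gives the short-time guarded limit `S`, and `RestartPrinciple` turns `S`
into the Statement itself. The packing guard `∀ t ∈ Ico 0 T, ∀ x, ρ t x * σ ^ 3 < η₀` is a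
hypothesis of the Statement, so no guard-removing input is needed. `GibbsLightCone` (the engine's
first rung, the intended first step of `LightConeInLaw`) is carried, not consumed. The `Assembly`
item is not a hypothesis (kind `assembly`); it is equivalent to `ConeLocalisation`
(`Theorems/RelayRaceLocalityAssemblyConeEquivalence.lean`). -/
@[closes "route-AtomisticToContinuum-RelayRaceLocality"] theorem closes (_h₁ : GibbsLightCone) (h₂ : LightConeInLaw) (h₃ : NearConstantShortTimeHL)
    (h₄ : RestartPrinciple) (h₅ : ConeLocalisation) :
    _root_.HydrodynamicLimit :=
  h₄ (h₅ h₂ h₃)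

end Summit.AtomisticToContinuum.HydrodynamicLimit.Theses.RelayRaceLocality
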